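import Summits.QuantumFields.BalabanUV.T4Continuum.Support.B13ReadingsDelta
import Summits.QuantumFields.BalabanUV.T4Continuum.Support.B13ReadingsLocal

/-!
# B13ReadingsAssembly — row O4-r ∕ leaf L07: W1 OF RECORD PRODUCED AT BAŁABAN's TIER-B BACKGROUND — the five `SpeciesEntryBound` conjuncts
# (cov: `B13ReadingsDecay`; `deltaKer`∕`gammaConstituent`: `B13ReadingsDelta`; `potQ`∕`potR`: `B13ReadingsLocal`) assembled at the slowest rate into ONE
# `SpeciesEntryBound` and the END-of-record binder `hwer : WeightedEntrywiseRate …`, every upstream binder displayed BY NAME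

Cell `pub-balaban`, unit `b2b-balaban-t4-ne5-p1` (row NE5 OWNER, gen 34; owner item «g34-b», the capstone of (M1) of the verdict sheet).  Summits-side NEW WORK
under the LEAN PLACEMENT RULE (a composition of landed theorems BY NAME; print cited for KIND only).  HONEST FRAMING: rung (B)+1 of the FINITE-VOLUME T⁴
continuum programme — NOT infinite volume, NOT a mass gap, NOT the Clay problem, NOT a proof of NE5 (NOT PRINTED: the series prints ε-UNIFORM bounds, never
η-RATES; GAPS G-t4-U3-1), NOT a proof of NE2 or NE3.  HONEST DEPENDENCY (cell, verbatim): continuum YM on T⁴ ⇐ BetaPertH ∧ nine spine estimates (0/9 proved);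
BetaPertH ⇐ (D1) ∧ (D4) ∧ CAP+tail; G-an2-4 gates asym, D1 and NE2/3/4.

WHAT (bookkeeping; no estimate on Bałaban's objects).  `CpertRec` abbreviates the operator-norm constant `Cpert(κ_B, 2dCst, CJ, C₂^B(C), 0, 1)` of the member of
record (a `def` of a real number, `CpertRec_eq` is `rfl`).  **`speciesEntryBound_balaban_ne3Shape`**: for a datum-indexed family `Rg V` over the admissible data `dom` of
node NE3's carrier, in the (3.35)-class with sizes under the threshold, ONE binder `NE3Shape (minActReadings …) C θ` (node U1b's full shape, OPEN — row NE3), and the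
DISPLAYED letters of the O1 instance — the covariance decay binder `hdec` + readings `ReadsTowerCovA∕B` + domination; the Δ species' slot-indexed op-Lipschitz readings
`hΦ`∕`hS₂`, `hΨ`∕`hS₃` + image decay binders `hdecΦ`, `hdecΨ` + readings `ReadsTowerDeltaA∕B`, `ReadsTowerGammaA∕B` + dominations; the potential species' Lipschitz
readings `PotQ∕PotRLipschitzReading` on the SAME carrier — the raw species of the two runs satisfy, at every step `k` of the window,
`SpeciesEntryBound (Fk k) (rawA g U k) (rawB g U k) (c·(√ρ′)^k)` with `ρ′ = max θ L⁻¹` and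
`c = √(2B₁·2CpertRec∕(1−ρ′)) + √(2B₂·Λ₂·CpertRec) + √(2B₃·Λ₃·CpertRec) + Λ₄C + Λ₅C` (`B13ReadingsLocal.speciesEntryBound_of_rates` at the slowest
rate `√ρ′ ≥ θ`); hence **`weightedEntrywiseRate_balaban_ne3Shape`**: `B13OpDatumJunctions.WeightedEntrywiseRate Fk (kernel ∘ rawA) (kernel ∘ rawB) W c (k ↦ (√ρ′)^k)` —
LITERALLY the W1 binder `hwer` of the END of record `B13StepEndInsOp.ne5_of_record_insOp` (via `B13Readings.weightedEntrywiseRate_of_entryBound`).  So on the END-of-record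
road, as on the tower road (`OutputRateTowerBalabanRate`), the ONLY upstream analytic binder of W1 type displayed is node U1b's `NE3Shape`; everything else displayed is
the class ∕ threshold or a READING ∕ decay ∕ Lipschitz LETTER of the O1 instance (substrate O-8 `slotsOfRecord`: tables `dk`∕`gc`∕`pQ`∕`pR` displayed; printed KIND
[Balaban1985BackgroundPropagators] Thm 3.4 p. 400 for the decay letters — asserted by nobody).  Rows NE2's ROOT B ∕ PART 4 ∕ PART 5 ∕ Δ3 are consumed BY NAME.
HONEST: model level (no B0); the supplier's background type is the carrier's datum type (as in `B13ReadingsDecay.cov_entryBound_balaban_ne3Shape`); NE5 ∕ NE2 ∕ NE3 NOT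
proved; 0∕12 leaves on Bałaban's concrete objects; spine 0∕9.  `FlowStep.BetaPertH`, (B), (B^μ) do not occur.  ABSOLUTE RULE kept; one `def` (a constant); 0 sorry.
-/

noncomputable section

open scoped BigOperators ComplexConjugate Matrix Matrix.Norms.L2Operator Kronecker

namespace Summit.QuantumFields.BalabanUV.T4Continuum.B13ReadingsAssembly

open Summit.QuantumFields.BalabanUV.T4Continuum
open Summit.QuantumFields.BalabanUV.T4Continuum.B13OpDatum
open Summit.QuantumFields.BalabanUV.T4Continuum.B13OpDatumJunctions (WeightedEntrywiseRate)
open Summit.QuantumFields.BalabanUV.T4Continuum.B13Readings (SpeciesEntryBound weightedEntrywiseRate_of_entryBound)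
open Summit.QuantumFields.BalabanUV.T4Continuum.B13ReadingsDecay (ReadsTowerCovA ReadsTowerCovB CovWeightDominatesDist
  cov_entryBound_balaban_rate)
open Summit.QuantumFields.BalabanUV.T4Continuum.B13ReadingsImage
open Summit.QuantumFields.BalabanUV.T4Continuum.B13ReadingsDelta (deltaKer_entryBound_balaban_rate gammaConstituent_entryBound_balaban_rate)
open Summit.QuantumFields.BalabanUV.T4Continuum.B13ReadingsLocal (PotQLipschitzReading PotRLipschitzReading
  potQ_entryBound_of_ne3Shape potR_entryBound_of_ne3Shape speciesEntryBound_of_rates)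
open Summit.QuantumFields.BalabanUV.T4Continuum.DecayRateInterpolation (EntryDecay)
open Summit.QuantumFields.BalabanUV.T4Continuum.CoerciveInverseTower (Coercive)
open Literature.MathematicalPhysics.QuantumFieldTheory.Balaban1983to89
open Literature.MathematicalPhysics.QuantumFieldTheory.Balaban1983to89.B5Prop11Plancherel (Cst Cst_nonneg Tor fine)
open Literature.MathematicalPhysics.QuantumFieldTheory.Balaban1983to89.B5G183RateUnitTower (lev lev_neZero)
open Literature.MathematicalPhysics.QuantumFieldTheory.Balaban1983to89.T4EtaRateMin (LocalRate NE3Shape)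
open Summit.QuantumFields.BalabanUV.T4Continuum.BalabanAveragedTowerUnit (idx Qlev)
open Summit.QuantumFields.BalabanUV.T4Continuum.BackgroundResolventTower
open Summit.QuantumFields.BalabanUV.T4Continuum.KingPairingPlantedLaw (calDalev JpcT CJ CJ_nonneg)
open Summit.QuantumFields.BalabanUV.T4Continuum.GramPerturbationLaw (C2gram)
open Summit.QuantumFields.BalabanUV.T4Continuum.NE2FromNE3 (bgReadings)
open Summit.QuantumFields.BalabanUV.T4Continuum.NE2ColourPerturbedLayer (pertCovC)
open Summit.QuantumFields.BalabanUV.T4Continuum.RegularBackgroundTower (RegularTransporters regClass betaNE3)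
open Summit.QuantumFields.BalabanUV.T4Continuum.GaugeTermScalarData (QuT Q1)
open Summit.QuantumFields.BalabanUV.T4Continuum.RegularSiteTransporters (siteT)
open Summit.QuantumFields.BalabanUV.T4Continuum.NestedContourTransport (theta0)
open Summit.QuantumFields.BalabanUV.T4Continuum.NE2BalabanRoot (balabanPert)
open Summit.QuantumFields.BalabanUV.T4Continuum.NE2BalabanGauge (gaugeSlot liftR)
open Summit.QuantumFields.BalabanUV.T4Continuum.NE2BalabanLayerSharp (kappaBs C2Bs KstarR)
open Summit.QuantumFields.BalabanUV.T4Continuum.NE2BalabanWiring (epsR CdeltaR epsR_nonneg)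
open Summit.QuantumFields.BalabanUV.T4Continuum.NE2BalabanFinal (tauR kappa4F C4F)
open Summit.QuantumFields.BalabanUV.T4Continuum.NE2BalabanThreshold (etaStar smallness_of_le)
open Summit.QuantumFields.BalabanUV.T4Continuum.NE2FromNE3Carrier (ne2Loc)
open Summit.QuantumFields.BalabanUV.T4Continuum.NE2BalabanFromNE3 (localRate_minActReadings_iff)
open Summit.QuantumFields.BalabanUV.T4Continuum.MinimalActionRate (minActReadings)

/-! ## §1 The operator-norm constant of the member of record, abbreviated -/

/-- DATA (a real number; no inequality): **`CpertRec o d L a α β C a′`** = `Cpert(κ_B, 2dCst, CJ, C₂^B(C), 0, 1)`, the operator-norm rate constant of the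
member of record at NE3 constant `C` — the constant displayed by `B13ReadingsDecay.balaban_twoLevelDecayRate_rate`, `B13ReadingsDelta.balaban_twoLevelOpRate_rate`
and `OutputRateTowerBalabanRate.Cpert_balaban_nonneg_rate` (spelled out there). [folklore] -/
def CpertRec (o : Type*) [Fintype o] [DecidableEq o] (d L : ℕ) (a α β C a' : ℝ) : ℝ :=
  Cpert (kappaBs o d a α β (a * (epsR o d α * (2 + epsR o d α) * Cst d a)) (kappa4F d a a' α β)) (2 * d * Cst d a) (CJ d a)
    (C2Bs o d L a α β C
      (a * C2gram (Cst d a) 1 (epsR o d α) (2 * d * Cst d a) (CJ d a) (Cst d a) (CdeltaR o d a α (theta0 d α (betaNE3 o C))))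
      (C4F o d L a a' α β C)) 0 1

/-- [folklore] `CpertRec` unfolds by `rfl`. -/
theorem CpertRec_eq (o : Type*) [Fintype o] [DecidableEq o] (d L : ℕ) (a α β C a' : ℝ) :
    CpertRec o d L a α β C a' =
      Cpert (kappaBs o d a α β (a * (epsR o d α * (2 + epsR o d α) * Cst d a)) (kappa4F d a a' α β)) (2 * d * Cst d a) (CJ d a)
        (C2Bs o d L a α β C
          (a * C2gram (Cst d a) 1 (epsR o d α) (2 * d * Cst d a) (CJ d a) (Cst d a) (CdeltaR o d a α (theta0 d α (betaNE3 o C))))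
          (C4F o d L a a' α β C)) 0 1 := rfl

/-! ## §2 The five species conjuncts assembled: W1 of record at Bałaban's tier-B background from `NE3Shape` and the O1 letters -/

section Balaban

variable {d : ℕ} (L : ℕ) [NeZero L] (M : Fin d → ℕ) [hM : ∀ μ, NeZero (M μ)] (a : ℝ) (ha : 0 < a)
variable {o : Type*} [Fintype o] [DecidableEq o] {α β C a' η : ℝ}
variable {T κ ι Ω 𝒴 m : Type*} [Fintype m] [DecidableEq m]

/-- [folklore] **W1 OF RECORD, ALL FIVE SPECIES, AT BAŁABAN's TIER-B BACKGROUND — ONE `SpeciesEntryBound` AT THE SLOWEST RATE `√(max θ L⁻¹)`.**  Displayed: the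
(3.35)-class `hreg`, `0 ≤ α, β, C`, node U1b's `NE3Shape (minActReadings …) C θ` (OPEN), the threshold `α, β ≤ η ≤ etaStar`, and the O1 LETTERS — cov: `hdec`,
`ReadsTowerCovA∕B`, domination at `δ₁∕2`; `deltaKer`: `hΦ`∕`hΛ₂`∕`hS₂`, `hdecΦ`, `ReadsTowerDeltaA∕B`, domination at `δ₂∕2`; `gammaConstituent`: `hΨ`∕`hΛ₃`∕`hS₃`, `hdecΨ`,
`ReadsTowerGammaA∕B`, domination at `δ₃∕2`; `potQ`∕`potR`: `PotQ∕PotRLipschitzReading` with `Λ₄, Λ₅ ≥ 0`.  Nothing of NE2 type; no rate binder. -/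
theorem speciesEntryBound_balaban_ne3Shape {𝒞 : ℕ → Set (B7Prop1Explicit.Site d → Fin d → (Matrix o o ℂ)ˣ)} {N : ℕ}
    {dom : Set (B7Prop1Explicit.Site d → Fin d → (Matrix o o ℂ)ˣ)} (hL : 2 ≤ L) (hd : 1 ≤ d)
    {RgV : (B7Prop1Explicit.Site d → Fin d → (Matrix o o ℂ)ˣ) → ((k : ℕ) → Fin d → (Tor (fine (lev L k) M) → Matrix o o ℂ))}
    (hreg : ∀ V ∈ dom, RegularTransporters L M (liftR L M (RgV V)) α β) (hα : 0 ≤ α) (hβ : 0 ≤ β) (hC : 0 ≤ C) {θ : ℝ}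
    (hNE3 : NE3Shape (minActReadings d 𝒞 L N dom (ne2Loc L M fun V => liftR L M (RgV V))) C θ)
    (ha' : 0 < a') (hαη : α ≤ η) (hβη : β ≤ η) (hη : η ≤ etaStar o d a a')
    {Fk : ℕ → Format (Species T κ ι Ω 𝒴)} {tow : ℕ → (ℕ → ℝ) → (B7Prop1Explicit.Site d → Fin d → (Matrix o o ℂ)ˣ) → ↥dom}
    {rawA rawB : (ℕ → ℝ) → (B7Prop1Explicit.Site d → Fin d → (Matrix o o ℂ)ˣ) → ℕ → RawSpecies T κ ι Ω 𝒴} {W : Set (ℕ → ℝ)}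
    -- the covariance species (D20)
    {σ : T → κ → idx L M 0 × o} {dist₁ : idx L M 0 × o → idx L M 0 × o → ℝ} {B₁ δ₁ : ℝ}
    (hdec : ∀ V ∈ dom, ∀ k, EntryDecay dist₁
      (pertCovC L M a ha (balabanPert L M a (liftR L M (RgV V)) (gaugeSlot L M (RgV V) (QuT L M o (siteT L M (RgV V))) (Q1 L M o) a'))
        1 k) B₁ δ₁)
    (hcovA : ReadsTowerCovA
      (fun V : ↥dom => pertCovC L M a ha
        (balabanPert L M a (liftR L M (RgV V)) (gaugeSlot L M (RgV V) (QuT L M o (siteT L M (RgV V))) (Q1 L M o) a')) 1)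
      σ tow rawA W)
    (hcovB : ReadsTowerCovB
      (fun V : ↥dom => pertCovC L M a ha
        (balabanPert L M a (liftR L M (RgV V)) (gaugeSlot L M (RgV V) (QuT L M o (siteT L M (RgV V))) (Q1 L M o) a')) 1)
      σ tow rawB W)
    (hdom₁ : CovWeightDominatesDist Fk dist₁ σ (δ₁ / 2))
    -- the `deltaKer` species (D22)
    {S₂ : Set (Matrix (idx L M 0 × o) (idx L M 0 × o) ℂ)} {Φ : T → Matrix (idx L M 0 × o) (idx L M 0 × o) ℂ → Matrix m m ℂ}
    {Λ₂ : ℝ} (hΦ : ∀ t, OpLipschitzOn S₂ (Φ t) Λ₂) (hΛ₂ : 0 ≤ Λ₂)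
    (hS₂ : ∀ V ∈ dom, ∀ k, pertCovC L M a ha
      (balabanPert L M a (liftR L M (RgV V)) (gaugeSlot L M (RgV V) (QuT L M o (siteT L M (RgV V))) (Q1 L M o) a')) 1 k ∈ S₂)
    {dist₂ : m → m → ℝ} {B₂ δ₂ : ℝ}
    (hdecΦ : ∀ V ∈ dom, ∀ t k, EntryDecay dist₂ (Φ t (pertCovC L M a ha
      (balabanPert L M a (liftR L M (RgV V)) (gaugeSlot L M (RgV V) (QuT L M o (siteT L M (RgV V))) (Q1 L M o) a')) 1 k)) B₂ δ₂)
    {σX : T → ι → m}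
    (hΔA : ReadsTowerDeltaA (fun (V : ↥dom) t k => Φ t (pertCovC L M a ha
      (balabanPert L M a (liftR L M (RgV V)) (gaugeSlot L M (RgV V) (QuT L M o (siteT L M (RgV V))) (Q1 L M o) a')) 1 k))
      σX tow rawA W)
    (hΔB : ReadsTowerDeltaB (fun (V : ↥dom) t k => Φ t (pertCovC L M a ha
      (balabanPert L M a (liftR L M (RgV V)) (gaugeSlot L M (RgV V) (QuT L M o (siteT L M (RgV V))) (Q1 L M o) a')) 1 k))
      σX tow rawB W)
    (hdom₂ : DeltaWeightDominatesDist Fk dist₂ σX (δ₂ / 2))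
    -- the `gammaConstituent` species (D22)
    {S₃ : Set (Matrix (idx L M 0 × o) (idx L M 0 × o) ℂ)} {Ψ : T → Matrix (idx L M 0 × o) (idx L M 0 × o) ℂ → Matrix m m ℂ}
    {Λ₃ : ℝ} (hΨ : ∀ t, OpLipschitzOn S₃ (Ψ t) Λ₃) (hΛ₃ : 0 ≤ Λ₃)
    (hS₃ : ∀ V ∈ dom, ∀ k, pertCovC L M a ha
      (balabanPert L M a (liftR L M (RgV V)) (gaugeSlot L M (RgV V) (QuT L M o (siteT L M (RgV V))) (Q1 L M o) a')) 1 k ∈ S₃)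
    {dist₃ : m → m → ℝ} {B₃ δ₃ : ℝ}
    (hdecΨ : ∀ V ∈ dom, ∀ t k, EntryDecay dist₃ (Ψ t (pertCovC L M a ha
      (balabanPert L M a (liftR L M (RgV V)) (gaugeSlot L M (RgV V) (QuT L M o (siteT L M (RgV V))) (Q1 L M o) a')) 1 k)) B₃ δ₃)
    {σB : T → κ → m}
    (hΓA : ReadsTowerGammaA (fun (V : ↥dom) t k => Ψ t (pertCovC L M a ha
      (balabanPert L M a (liftR L M (RgV V)) (gaugeSlot L M (RgV V) (QuT L M o (siteT L M (RgV V))) (Q1 L M o) a')) 1 k))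
      σB σX tow rawA W)
    (hΓB : ReadsTowerGammaB (fun (V : ↥dom) t k => Ψ t (pertCovC L M a ha
      (balabanPert L M a (liftR L M (RgV V)) (gaugeSlot L M (RgV V) (QuT L M o (siteT L M (RgV V))) (Q1 L M o) a')) 1 k))
      σB σX tow rawB W)
    (hdom₃ : GammaWeightDominatesDist Fk dist₃ σB σX (δ₃ / 2))
    -- the potential species (D20′)
    {Λ₄ Λ₅ : ℝ} (hΛ₄ : 0 ≤ Λ₄) (hΛ₅ : 0 ≤ Λ₅)
    (hQ : PotQLipschitzReading (minActReadings d 𝒞 L N dom (ne2Loc L M fun V => liftR L M (RgV V))) Fk rawA rawB W Λ₄)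
    (hR : PotRLipschitzReading (minActReadings d 𝒞 L N dom (ne2Loc L M fun V => liftR L M (RgV V))) Fk rawA rawB W Λ₅)
    (k : ℕ) {g : ℕ → ℝ} (hg : g ∈ W) (U : B7Prop1Explicit.Site d → Fin d → (Matrix o o ℂ)ˣ) :
    SpeciesEntryBound (Fk k) (rawA g U k) (rawB g U k)
      ((Real.sqrt (2 * B₁ * (2 * CpertRec o d L a α β C a' / (1 - max θ ((L : ℝ)⁻¹)))) +
          Real.sqrt (2 * B₂ * (Λ₂ * CpertRec o d L a α β C a')) +
          Real.sqrt (2 * B₃ * (Λ₃ * CpertRec o d L a α β C a')) +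
          Λ₄ * C + Λ₅ * C) * Real.sqrt (max θ ((L : ℝ)⁻¹)) ^ k) := by
  have hL1 : (1 : ℝ) < L := by exact_mod_cast (lt_of_lt_of_le one_lt_two hL : 1 < L)
  have hlt : max θ ((L : ℝ)⁻¹) < 1 := max_lt hNE3.rate_lt_one (inv_lt_one_of_one_lt₀ hL1)
  have hρ0 : 0 ≤ max θ ((L : ℝ)⁻¹) := hNE3.rate_nonneg.trans (le_max_left _ _)
  have hloc : ∀ V ∈ dom, LocalRate (bgReadings L M (regClass L M (liftR L M (RgV V)))) C (max θ ((L : ℝ)⁻¹)) := fun V hV =>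
    ((localRate_minActReadings_iff L M).1 hNE3.pointwise V hV).mono le_rfl hNE3.rate_nonneg (le_max_left _ _) hC
  -- `θ ≤ max θ L⁻¹ ≤ √(max θ L⁻¹)` (on `[0,1]` a number is at most its square root; the tree's copy of this one-liner lives under an
  -- unrelated import cone, so it is inlined)
  have hθΘ : θ ≤ Real.sqrt (max θ ((L : ℝ)⁻¹)) := by
    have hs : Real.sqrt (max θ ((L : ℝ)⁻¹)) ≤ 1 := by
      rw [show (1 : ℝ) = Real.sqrt 1 from Real.sqrt_one.symm]
      exact Real.sqrt_le_sqrt hlt.le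
    calc θ ≤ max θ ((L : ℝ)⁻¹) := le_max_left _ _
      _ = Real.sqrt (max θ ((L : ℝ)⁻¹)) * Real.sqrt (max θ ((L : ℝ)⁻¹)) := (Real.mul_self_sqrt hρ0).symm
      _ ≤ Real.sqrt (max θ ((L : ℝ)⁻¹)) * 1 := mul_le_mul_of_nonneg_left hs (Real.sqrt_nonneg _)
      _ = Real.sqrt (max θ ((L : ℝ)⁻¹)) := mul_one _
  have hΛC₄ : 0 ≤ Λ₄ * C := mul_nonneg hΛ₄ hC
  have hΛC₅ : 0 ≤ Λ₅ * C := mul_nonneg hΛ₅ hC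
  unfold CpertRec
  refine speciesEntryBound_of_rates
    (fun t a'' a''' => cov_entryBound_balaban_rate L M a ha hd hreg hα hβ hC (le_max_right _ _) hlt hloc ha' hαη hβη hη hdec hcovA hcovB
      hdom₁ k hg U t a'' a''')
    (fun t i j => deltaKer_entryBound_balaban_rate L M a ha hd hreg hα hβ hC (le_max_right _ _) hlt hloc ha' hαη hβη hη hΦ hΛ₂ hS₂ hdecΦ
      hΔA hΔB hdom₂ k hg U t i j)
    (fun t a'' i => gammaConstituent_entryBound_balaban_rate L M a ha hd hreg hα hβ hC (le_max_right _ _) hlt hloc ha' hαη hβη hη hΨ hΛ₃ hS₃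
      hdecΨ hΓA hΓB hdom₃ k hg U t a'' i)
    (fun x Y b b' => potQ_entryBound_of_ne3Shape hΛ₄ hNE3 hQ k hg U x Y b b')
    (fun x Y => potR_entryBound_of_ne3Shape hΛ₅ hNE3 hR k hg U x Y)
    (Real.sqrt_nonneg _) (Real.sqrt_nonneg _) (Real.sqrt_nonneg _) hΛC₄ hΛC₅ ?_ ?_ ?_ ?_ ?_
    (Real.sqrt_nonneg _) (Real.sqrt_nonneg _) (Real.sqrt_nonneg _) hNE3.rate_nonneg hNE3.rate_nonneg le_rfl le_rfl le_rfl hθΘ hθΘ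
  all_goals
    linarith [Real.sqrt_nonneg (2 * B₁ * (2 *
        Cpert (kappaBs o d a α β (a * (epsR o d α * (2 + epsR o d α) * Cst d a)) (kappa4F d a a' α β)) (2 * d * Cst d a) (CJ d a)
          (C2Bs o d L a α β C
            (a * C2gram (Cst d a) 1 (epsR o d α) (2 * d * Cst d a) (CJ d a) (Cst d a) (CdeltaR o d a α (theta0 d α (betaNE3 o C))))
            (C4F o d L a a' α β C)) 0 1 / (1 - max θ ((L : ℝ)⁻¹)))),
      Real.sqrt_nonneg (2 * B₂ * (Λ₂ *
        Cpert (kappaBs o d a α β (a * (epsR o d α * (2 + epsR o d α) * Cst d a)) (kappa4F d a a' α β)) (2 * d * Cst d a) (CJ d a)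
          (C2Bs o d L a α β C
            (a * C2gram (Cst d a) 1 (epsR o d α) (2 * d * Cst d a) (CJ d a) (Cst d a) (CdeltaR o d a α (theta0 d α (betaNE3 o C))))
            (C4F o d L a a' α β C)) 0 1)),
      Real.sqrt_nonneg (2 * B₃ * (Λ₃ *
        Cpert (kappaBs o d a α β (a * (epsR o d α * (2 + epsR o d α) * Cst d a)) (kappa4F d a a' α β)) (2 * d * Cst d a) (CJ d a)
          (C2Bs o d L a α β C
            (a * C2gram (Cst d a) 1 (epsR o d α) (2 * d * Cst d a) (CJ d a) (Cst d a) (CdeltaR o d a α (theta0 d α (betaNE3 o C))))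
            (C4F o d L a a' α β C)) 0 1))]

/-- [folklore] **THE END-OF-RECORD W1 BINDER `hwer` PRODUCED**: with the data of `speciesEntryBound_balaban_ne3Shape`,
`WeightedEntrywiseRate Fk (kernel ∘ rawA) (kernel ∘ rawB) W c (k ↦ (√(max θ L⁻¹))^k)` — LITERALLY the `hwer` binder of `B13StepEndInsOp.ne5_of_record_insOp` (and of
every END of record built on it), by `B13Readings.weightedEntrywiseRate_of_entryBound`.  The only upstream analytic binder of W1 type displayed is `NE3Shape`. -/
theorem weightedEntrywiseRate_balaban_ne3Shape {𝒞 : ℕ → Set (B7Prop1Explicit.Site d → Fin d → (Matrix o o ℂ)ˣ)} {N : ℕ}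
    {dom : Set (B7Prop1Explicit.Site d → Fin d → (Matrix o o ℂ)ˣ)} (hL : 2 ≤ L) (hd : 1 ≤ d)
    {RgV : (B7Prop1Explicit.Site d → Fin d → (Matrix o o ℂ)ˣ) → ((k : ℕ) → Fin d → (Tor (fine (lev L k) M) → Matrix o o ℂ))}
    (hreg : ∀ V ∈ dom, RegularTransporters L M (liftR L M (RgV V)) α β) (hα : 0 ≤ α) (hβ : 0 ≤ β) (hC : 0 ≤ C) {θ : ℝ}
    (hNE3 : NE3Shape (minActReadings d 𝒞 L N dom (ne2Loc L M fun V => liftR L M (RgV V))) C θ)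
    (ha' : 0 < a') (hαη : α ≤ η) (hβη : β ≤ η) (hη : η ≤ etaStar o d a a')
    {Fk : ℕ → Format (Species T κ ι Ω 𝒴)} {tow : ℕ → (ℕ → ℝ) → (B7Prop1Explicit.Site d → Fin d → (Matrix o o ℂ)ˣ) → ↥dom}
    {rawA rawB : (ℕ → ℝ) → (B7Prop1Explicit.Site d → Fin d → (Matrix o o ℂ)ˣ) → ℕ → RawSpecies T κ ι Ω 𝒴} {W : Set (ℕ → ℝ)}
    {σ : T → κ → idx L M 0 × o} {dist₁ : idx L M 0 × o → idx L M 0 × o → ℝ} {B₁ δ₁ : ℝ}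
    (hdec : ∀ V ∈ dom, ∀ k, EntryDecay dist₁
      (pertCovC L M a ha (balabanPert L M a (liftR L M (RgV V)) (gaugeSlot L M (RgV V) (QuT L M o (siteT L M (RgV V))) (Q1 L M o) a'))
        1 k) B₁ δ₁)
    (hcovA : ReadsTowerCovA
      (fun V : ↥dom => pertCovC L M a ha
        (balabanPert L M a (liftR L M (RgV V)) (gaugeSlot L M (RgV V) (QuT L M o (siteT L M (RgV V))) (Q1 L M o) a')) 1)
      σ tow rawA W)
    (hcovB : ReadsTowerCovB
      (fun V : ↥dom => pertCovC L M a ha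
        (balabanPert L M a (liftR L M (RgV V)) (gaugeSlot L M (RgV V) (QuT L M o (siteT L M (RgV V))) (Q1 L M o) a')) 1)
      σ tow rawB W)
    (hdom₁ : CovWeightDominatesDist Fk dist₁ σ (δ₁ / 2))
    {S₂ : Set (Matrix (idx L M 0 × o) (idx L M 0 × o) ℂ)} {Φ : T → Matrix (idx L M 0 × o) (idx L M 0 × o) ℂ → Matrix m m ℂ}
    {Λ₂ : ℝ} (hΦ : ∀ t, OpLipschitzOn S₂ (Φ t) Λ₂) (hΛ₂ : 0 ≤ Λ₂)
    (hS₂ : ∀ V ∈ dom, ∀ k, pertCovC L M a ha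
      (balabanPert L M a (liftR L M (RgV V)) (gaugeSlot L M (RgV V) (QuT L M o (siteT L M (RgV V))) (Q1 L M o) a')) 1 k ∈ S₂)
    {dist₂ : m → m → ℝ} {B₂ δ₂ : ℝ}
    (hdecΦ : ∀ V ∈ dom, ∀ t k, EntryDecay dist₂ (Φ t (pertCovC L M a ha
      (balabanPert L M a (liftR L M (RgV V)) (gaugeSlot L M (RgV V) (QuT L M o (siteT L M (RgV V))) (Q1 L M o) a')) 1 k)) B₂ δ₂)
    {σX : T → ι → m}
    (hΔA : ReadsTowerDeltaA (fun (V : ↥dom) t k => Φ t (pertCovC L M a ha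
      (balabanPert L M a (liftR L M (RgV V)) (gaugeSlot L M (RgV V) (QuT L M o (siteT L M (RgV V))) (Q1 L M o) a')) 1 k))
      σX tow rawA W)
    (hΔB : ReadsTowerDeltaB (fun (V : ↥dom) t k => Φ t (pertCovC L M a ha
      (balabanPert L M a (liftR L M (RgV V)) (gaugeSlot L M (RgV V) (QuT L M o (siteT L M (RgV V))) (Q1 L M o) a')) 1 k))
      σX tow rawB W)
    (hdom₂ : DeltaWeightDominatesDist Fk dist₂ σX (δ₂ / 2))
    {S₃ : Set (Matrix (idx L M 0 × o) (idx L M 0 × o) ℂ)} {Ψ : T → Matrix (idx L M 0 × o) (idx L M 0 × o) ℂ → Matrix m m ℂ}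
    {Λ₃ : ℝ} (hΨ : ∀ t, OpLipschitzOn S₃ (Ψ t) Λ₃) (hΛ₃ : 0 ≤ Λ₃)
    (hS₃ : ∀ V ∈ dom, ∀ k, pertCovC L M a ha
      (balabanPert L M a (liftR L M (RgV V)) (gaugeSlot L M (RgV V) (QuT L M o (siteT L M (RgV V))) (Q1 L M o) a')) 1 k ∈ S₃)
    {dist₃ : m → m → ℝ} {B₃ δ₃ : ℝ}
    (hdecΨ : ∀ V ∈ dom, ∀ t k, EntryDecay dist₃ (Ψ t (pertCovC L M a ha
      (balabanPert L M a (liftR L M (RgV V)) (gaugeSlot L M (RgV V) (QuT L M o (siteT L M (RgV V))) (Q1 L M o) a')) 1 k)) B₃ δ₃)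
    {σB : T → κ → m}
    (hΓA : ReadsTowerGammaA (fun (V : ↥dom) t k => Ψ t (pertCovC L M a ha
      (balabanPert L M a (liftR L M (RgV V)) (gaugeSlot L M (RgV V) (QuT L M o (siteT L M (RgV V))) (Q1 L M o) a')) 1 k))
      σB σX tow rawA W)
    (hΓB : ReadsTowerGammaB (fun (V : ↥dom) t k => Ψ t (pertCovC L M a ha
      (balabanPert L M a (liftR L M (RgV V)) (gaugeSlot L M (RgV V) (QuT L M o (siteT L M (RgV V))) (Q1 L M o) a')) 1 k))
      σB σX tow rawB W)
    (hdom₃ : GammaWeightDominatesDist Fk dist₃ σB σX (δ₃ / 2))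
    {Λ₄ Λ₅ : ℝ} (hΛ₄ : 0 ≤ Λ₄) (hΛ₅ : 0 ≤ Λ₅)
    (hQ : PotQLipschitzReading (minActReadings d 𝒞 L N dom (ne2Loc L M fun V => liftR L M (RgV V))) Fk rawA rawB W Λ₄)
    (hR : PotRLipschitzReading (minActReadings d 𝒞 L N dom (ne2Loc L M fun V => liftR L M (RgV V))) Fk rawA rawB W Λ₅) :
    WeightedEntrywiseRate Fk (fun g U k => (rawA g U k).kernel) (fun g U k => (rawB g U k).kernel) W
      (Real.sqrt (2 * B₁ * (2 * CpertRec o d L a α β C a' / (1 - max θ ((L : ℝ)⁻¹)))) +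
          Real.sqrt (2 * B₂ * (Λ₂ * CpertRec o d L a α β C a')) +
          Real.sqrt (2 * B₃ * (Λ₃ * CpertRec o d L a α β C a')) +
          Λ₄ * C + Λ₅ * C)
      (fun k => Real.sqrt (max θ ((L : ℝ)⁻¹)) ^ k) :=
  weightedEntrywiseRate_of_entryBound fun k _ hg U =>
    speciesEntryBound_balaban_ne3Shape L M a ha hL hd hreg hα hβ hC hNE3 ha' hαη hβη hη hdec hcovA hcovB hdom₁ hΦ hΛ₂ hS₂ hdecΦ hΔA hΔB
      hdom₂ hΨ hΛ₃ hS₃ hdecΨ hΓA hΓB hdom₃ hΛ₄ hΛ₅ hQ hR k hg U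

end Balaban

end Summit.QuantumFields.BalabanUV.T4Continuum.B13ReadingsAssembly

end
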